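import Mathlib.Algebra.Order.BigOperators.Group.Finset
import Mathlib.Combinatorics.SimpleGraph.Clique
import Mathlib.Order.Preorder.Finite
import HarnessLib

/-!
# The greedy (maximal independent set) bound `|K| ≤ (Δ + 1) · α` for bounded-degree graphs

Topic `Literature/Combinatorics/SimpleGraph`.  The most elementary lower bound for independent
sets in graphs of bounded degree, in Mathlib's `SimpleGraph` vocabulary (`SimpleGraph.IsIndepSet`,
`SimpleGraph.degree`, `SimpleGraph.maxDegree`, `SimpleGraph.indepNum`); Mathlib (v4.32.0,
`Combinatorics/SimpleGraph/Clique.lean`) has `IsIndepSet.card_le_indepNum` but no lower bound of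
this kind.

* `exists_isIndepSet_card_le_mul` — relative form: if every vertex of a finite vertex set `K` of a
  locally finite graph `G` has degree `≤ Δ`, there is an independent set `X ⊆ K` of `G` with
  `K.card ≤ (Δ + 1) * X.card`.  Proof: an inclusion-maximal independent `X ⊆ K` exists (finite
  poset, `Finset.exists_maximal`) and dominates `K` — every `k ∈ K` lies in `X` or is adjacent to
  a vertex of `X`, for otherwise `insert k X` would be a larger independent subset of `K` — so `K`
  is covered by the `X.card` closed neighbourhoods `{x} ∪ N(x)`, each of size `≤ Δ + 1`
  (`Finset.card_biUnion_le_card_mul`).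
* `card_le_maxDegree_succ_mul`, `card_le_maxDegree_succ_mul_indepNum` — absolute forms on a finite
  vertex type: some independent `X` has `Fintype.card V ≤ (G.maxDegree + 1) * X.card`, hence
  `Fintype.card V ≤ (G.maxDegree + 1) * G.indepNum`, i.e. `α(G) ≥ n / (Δ(G) + 1)`.

This is the greedy bound; the sharper degree-sequence bound `α(G) ≥ Σ_v 1/(d(v) + 1)` (Caro 1979,
Wei 1981) and Turán's `α(G) ≥ n/(d̄ + 1)` are NOT proved here.  First consumer: the Cayley-graph
deletion step (`|K| ≤ (2|B| + 1)|X|` for `X ⊆ K ⊆ S_n` avoiding `B` as a quotient) of crux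
`Summit.MatrixMultiplication.MatrixMultiplication.Theses.SnSubsetDichotomy.ThresholdSubsetTriples`
(`stmt-MatrixMultiplication-10882`), where the graph is the Cayley graph of `B ∪ B⁻¹`, of degree
`≤ 2|B|`.  [folklore]
-/

namespace Literature.Combinatorics.SimpleGraph

open _root_.SimpleGraph

/-- **Greedy independence bound, relative form.**  Let `G` be a locally finite simple graph and
`K` a finite set of vertices each of degree `≤ Δ` in `G`.  Then there is an independent set
`X ⊆ K` of `G` (`SimpleGraph.IsIndepSet`) with `K.card ≤ (Δ + 1) * X.card`: an inclusion-maximal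
independent subset of `K` dominates `K`, and closed neighbourhoods have `≤ Δ + 1` vertices.
[folklore] -/
theorem exists_isIndepSet_card_le_mul {V : Type*} (G : _root_.SimpleGraph V) [G.LocallyFinite]
    (K : Finset V) {Δ : ℕ} (hΔ : ∀ v ∈ K, G.degree v ≤ Δ) :
    ∃ X ⊆ K, G.IsIndepSet (X : Set V) ∧ K.card ≤ (Δ + 1) * X.card := by
  classical
  -- the independent subsets of `K`, and an inclusion-maximal one
  set F : Finset (Finset V) := K.powerset.filter fun Y => G.IsIndepSet (Y : Set V) with hF
  have hF0 : (∅ : Finset V) ∈ F := by simp [hF, isIndepSet_iff]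
  obtain ⟨X, hXmax⟩ := F.exists_maximal ⟨∅, hF0⟩
  have hXF : X ∈ F := hXmax.prop
  rw [hF, Finset.mem_filter, Finset.mem_powerset] at hXF
  obtain ⟨hXK, hXI⟩ := hXF
  refine ⟨X, hXK, hXI, ?_⟩
  -- domination: `K` is covered by the closed neighbourhoods of the vertices of `X`
  have hdom : K ⊆ X.biUnion fun x => insert x (G.neighborFinset x) := by
    intro k hk
    by_contra hkn
    simp only [Finset.mem_biUnion, Finset.mem_insert, mem_neighborFinset, not_exists, not_and,
      not_or] at hkn
    -- otherwise `insert k X` is again an independent subset of `K`, contradicting maximality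
    have hins : insert k X ∈ F := by
      rw [hF, Finset.mem_filter, Finset.mem_powerset, Finset.coe_insert]
      exact ⟨Finset.insert_subset hk hXK,
        Set.Pairwise.insert hXI fun x hx _ => ⟨fun h => (hkn x hx).2 h.symm, (hkn x hx).2⟩⟩
    have hkX : k ∈ X := hXmax.2 hins (Finset.subset_insert k X) (Finset.mem_insert_self k X)
    exact (hkn k hkX).1 rfl
  calc K.card ≤ (X.biUnion fun x => insert x (G.neighborFinset x)).card := Finset.card_le_card hdom
    _ ≤ X.card * (Δ + 1) := by
        refine Finset.card_biUnion_le_card_mul _ _ _ fun x hx =>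
          (Finset.card_insert_le _ _).trans ?_
        rw [card_neighborFinset_eq_degree]
        exact Nat.add_le_add_right (hΔ x (hXK hx)) 1
    _ = (Δ + 1) * X.card := mul_comm _ _

/-- **Greedy independence bound, absolute form.**  A finite simple graph `G` has an independent
set `X` with `Fintype.card V ≤ (G.maxDegree + 1) * X.card`. [folklore] -/
theorem card_le_maxDegree_succ_mul {V : Type*} [Fintype V] (G : _root_.SimpleGraph V)
    [DecidableRel G.Adj] :
    ∃ X : Finset V, G.IsIndepSet (X : Set V) ∧ Fintype.card V ≤ (G.maxDegree + 1) * X.card := by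
  obtain ⟨X, -, hXI, hcard⟩ :=
    exists_isIndepSet_card_le_mul G Finset.univ fun v _ => G.degree_le_maxDegree v
  exact ⟨X, hXI, by simpa only [Finset.card_univ] using hcard⟩

/-- **Greedy bound for the independence number**:
`Fintype.card V ≤ (G.maxDegree + 1) * G.indepNum`, i.e. `α(G) ≥ n / (Δ(G) + 1)`, for every
finite simple graph `G`. [folklore] -/
theorem card_le_maxDegree_succ_mul_indepNum {V : Type*} [Fintype V] (G : _root_.SimpleGraph V)
    [DecidableRel G.Adj] : Fintype.card V ≤ (G.maxDegree + 1) * G.indepNum := by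
  obtain ⟨X, hXI, hcard⟩ := card_le_maxDegree_succ_mul G
  exact hcard.trans (Nat.mul_le_mul_left _ hXI.card_le_indepNum)

end Literature.Combinatorics.SimpleGraph
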